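import Summits.FinalStateConjecture.FinalStateConjecture.Theorems.EIHFluxBalanceInertialRecessionStubSlaving3JetScaling
import Summits.FinalStateConjecture.FinalStateConjecture.Theorems.EIHFluxBalanceInertialRecessionBoostAlgebra
import Summits.FinalStateConjecture.FinalStateConjecture.Theorems.EIHFluxBalanceInertialRecessionLabVelocity
import Summits.FinalStateConjecture.FinalStateConjecture.Theorems.EIHFluxBalanceInertialRecessionStubQuasiStationarityStabiliser
import Summits.FinalStateConjecture.FinalStateConjecture.Theorems.EIHFluxBalanceInertialRecessionStubPseudotensorBoundMatrix

/-!
# Route EIHFluxBalance — `InertialRecession`, line `sublinear-is-free-clean-window-charges`: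
# degree laws for composites and representatives of painted Schwarzschild summands
# (slaving stub `stub_slaving`, fact "F3": cross-hole decoupling — preparations)

Helper file for the crux `stmt-FinalStateConjecture-10166`
(`Summit.FinalStateConjecture.FinalStateConjecture.Theses.EIHFluxBalance.InertialRecession`),
stub `stub_slaving`. Inputs of the far-field estimate `exists_norm_iteratedFDeriv_schwarzschildSummand_le_pow`
(companion file `…StubSlaving3FarField`): the other holes' summands at hole `i` must be small
together with their lab derivatives in terms of the EFFECTIVE jets (those of the painted
`4`-velocity `uⱼ = Λⱼ e₀` and of the centre `ξⱼ`), not of the operator path `s ↦ Λⱼ(s)` (which also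
contains the rates of the internal rotational freedom `Λ ↦ Λ R`, `R ∈ Stab(e₀)`, invisible in the
field of a Schwarzschild hole and unconstrained by the crux).

* `norm_iteratedDeriv_comp_le_pow` — generic DEGREE LAW for composites `g ∘ w : ℝ → G` (Faà di
  Bruno, `norm_iteratedFDerivWithin_comp_le`): `‖w⁽ⁱ⁾(t)‖ ≤ Γⁱ` (`1 ≤ i ≤ k`) and `‖Dⁱg‖ ≤ C` at
  `w(t)` give `‖(g ∘ w)⁽ʲ⁾(t)‖ ≤ j! C Γʲ`;
* `exists_forall_norm_iteratedFDeriv_le_of_isCompact` — uniform bounds for `Dⁱg`, `i ≤ k`, on a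
  compact subset of an open set of smoothness;
* `exists_norm_iteratedDeriv_boostCLM_neg_le_pow`, `exists_norm_iteratedDeriv_labVelocity_le_pow` —
  degree laws for the rest-frame boost `s ↦ boostCLM(−v(s))` in the jets of `v`, and for the lab
  velocity `v = ũ/u⁰` in the jets of `u` (both signs of `u⁰`);
* `labVelocity_facts`, `boost_labVelocity_apply_basisVector_zero` — speed, size and Lorentz factor of
  the painted `4`-velocity, sign-blind; `boost(v) e₀ = ±u`;
* `boostedKerrBilin_zero_spin_eq_boost_repr`, `…_eq_reflect_boost_repr` — **representatives**: a
  Schwarzschild summand painted with ANY `Λ ∈ O(1,3)` is the summand painted with the pure boost of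
  its lab velocity (composed with the time reflection if `Λ` reverses time), by the isotropy of
  `g_{M,0}` (`QuasiStationarity.schwarzschild_isotropy`).
-/

set_option linter.dupNamespace false
set_option maxSynthPendingDepth 3

noncomputable section

open scoped Topology ContDiff Nat
open Filter Set Function Metric Literature.Geometry.Lorentzian
  Summit.FinalStateConjecture.FinalStateConjecture.Theorems
  Summit.FinalStateConjecture.FinalStateConjecture.Theorems.SublinearIsFree

namespace Summit.FinalStateConjecture.FinalStateConjecture.Theorems.SublinearIsFree.Slaving

/-! ### Degree law for composites -/

section Composite

variable {F G : Type*} [NormedAddCommGroup F] [NormedSpace ℝ F] [NormedAddCommGroup G]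
  [NormedSpace ℝ G]

/-- **Degree law for composites** `g ∘ w : ℝ → G`: if `g` is `Cᵏ` on an open `O ∋ w(t)` with
`‖Dⁱg(w(t))‖ ≤ C` (`i ≤ k`), and `‖w⁽ⁱ⁾(t)‖ ≤ Γⁱ` (`1 ≤ i ≤ k`), then
`‖(g ∘ w)⁽ʲ⁾(t)‖ ≤ j! C Γʲ` for `j ≤ k` (Faà di Bruno: Mathlib's `norm_iteratedFDerivWithin_comp_le` on
the open preimage `w⁻¹(O)`). [folklore] -/
theorem norm_iteratedDeriv_comp_le_pow {g : F → G} {O : Set F} (hO : IsOpen O) {k : ℕ}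
    (hg : ContDiffOn ℝ k g O) {w : ℝ → F} (hw : ContDiff ℝ k w) {t : ℝ} (hwt : w t ∈ O) {C Γ : ℝ}
    (hC : ∀ i ≤ k, ‖iteratedFDeriv ℝ i g (w t)‖ ≤ C)
    (hΓ : ∀ i, 1 ≤ i → i ≤ k → ‖iteratedDeriv i w t‖ ≤ Γ ^ i) {j : ℕ} (hj : j ≤ k) :
    ‖iteratedDeriv j (g ∘ w) t‖ ≤ j ! * C * Γ ^ j := by
  set s : Set ℝ := w ⁻¹' O with hs
  have hso : IsOpen s := hO.preimage hw.continuous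
  have hts : t ∈ s := hwt
  have hcomp := norm_iteratedFDerivWithin_comp_le (g := g) (f := w) (n := j)
    (N := ((k : ℕ∞) : WithTop ℕ∞)) (x := t) hg hw.contDiffOn (by exact_mod_cast hj) hO.uniqueDiffOn
    hso.uniqueDiffOn (fun y hy ↦ hy) hts (C := C) (D := Γ)
    (fun i hi ↦ by
      rw [iteratedFDerivWithin_of_isOpen i hO hwt]
      exact hC i (hi.trans hj))
    (fun i hi1 hij ↦ by
      rw [iteratedFDerivWithin_of_isOpen i hso hts, norm_iteratedFDeriv_eq_norm_iteratedDeriv]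
      exact hΓ i hi1 (hij.trans hj))
  rw [iteratedFDerivWithin_of_isOpen j hso hts] at hcomp
  rwa [← norm_iteratedFDeriv_eq_norm_iteratedDeriv]

/-- **Uniform bounds for the derivatives of a smooth map on a compact subset of its domain**: for
`g` `C^∞` on an open `O ⊇ K`, `K` compact, and every `k` there is `C ≥ 0` with `‖Dⁱg(u)‖ ≤ C` for
all `u ∈ K`, `i ≤ k` (continuity of `Dⁱg` on `O`). [folklore] -/
theorem exists_forall_norm_iteratedFDeriv_le_of_isCompact {g : F → G} {O K : Set F} (hO : IsOpen O)
    (hg : ContDiffOn ℝ ∞ g O) (hK : IsCompact K) (hKO : K ⊆ O) (k : ℕ) :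
    ∃ C : ℝ, 0 ≤ C ∧ ∀ u ∈ K, ∀ i ≤ k, ‖iteratedFDeriv ℝ i g u‖ ≤ C := by
  have hbound : ∀ i : ℕ, ∃ C : ℝ, ∀ u ∈ K, ‖iteratedFDeriv ℝ i g u‖ ≤ C := by
    intro i
    have h1 := hg.continuousOn_iteratedFDerivWithin (m := i) (by exact_mod_cast le_top)
      hO.uniqueDiffOn
    have h2 := h1.congr (g := iteratedFDeriv ℝ i g)
      fun p hp ↦ (iteratedFDerivWithin_of_isOpen i hO hp).symm
    obtain ⟨C, hC⟩ := hK.exists_bound_of_continuousOn (h2.mono hKO)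
    exact ⟨C, hC⟩
  choose C hC using hbound
  refine ⟨∑ i ∈ Finset.range (k + 1), |C i|, Finset.sum_nonneg fun _ _ ↦ abs_nonneg _,
    fun u hu i hi ↦ ?_⟩
  exact ((hC i u hu).trans (le_abs_self _)).trans
    (Finset.single_le_sum (f := fun i ↦ |C i|) (fun _ _ ↦ abs_nonneg _)
      (Finset.mem_range.mpr (Nat.lt_succ_of_le hi)))

end Composite

/-! ### Degree laws for the rest-frame boost and for the lab velocity -/

-- operator-norm instance paths on operator-valued maps are slow to unify
set_option synthInstance.maxHeartbeats 200000 in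
/-- **Degree law for the rest-frame boost.** For every order `k` and speed bound `κ₀ < 1` there is
`C ≥ 0` such that for every `Cᵏ` velocity path `v` with `‖v(t)‖ ≤ κ₀` and `‖v⁽ⁱ⁾(t)‖ ≤ Γⁱ`
(`1 ≤ i ≤ k`): `‖(s ↦ boostCLM(−v(s)))⁽ʲ⁾(t)‖ ≤ C Γʲ` for all `j ≤ k` (smoothness of
`u ↦ boostCLM(−u)` on the unit ball, `contDiffOn_boostCLM`; degree law for composites). [folklore] -/
theorem exists_norm_iteratedDeriv_boostCLM_neg_le_pow (k : ℕ) {κ₀ : ℝ} (hκ₀ : κ₀ < 1) :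
    ∃ C : ℝ, 0 ≤ C ∧ ∀ (v : ℝ → E3) (t : ℝ) (Γ : ℝ), 1 ≤ Γ → ContDiff ℝ k v → ‖v t‖ ≤ κ₀ →
      (∀ i, 1 ≤ i → i ≤ k → ‖iteratedDeriv i v t‖ ≤ Γ ^ i) →
      ∀ j ≤ k, ‖iteratedDeriv j (fun s ↦ Lorentz.boostCLM (-v s)) t‖ ≤ C * Γ ^ j := by
  set g : E3 → E4 →L[ℝ] E4 := fun u ↦ Lorentz.boostCLM (-u) with hg
  have hgc : ContDiffOn ℝ ∞ g (ball (0 : E3) 1) := by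
    refine contDiffOn_boostCLM.comp contDiff_neg.contDiffOn fun u hu ↦ ?_
    simpa using hu
  have hOo : IsOpen (ball (0 : E3) 1) := isOpen_ball
  have hKO : closedBall (0 : E3) κ₀ ⊆ ball 0 1 := closedBall_subset_ball hκ₀
  obtain ⟨C, hC0, hC⟩ := exists_forall_norm_iteratedFDeriv_le_of_isCompact hOo hgc
    (isCompact_closedBall _ _) hKO k
  refine ⟨k ! * C, by positivity, fun v t Γ hΓ1 hv hvt hvb j hj ↦ ?_⟩
  have hvt' : v t ∈ closedBall (0 : E3) κ₀ := by simpa using hvt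
  have hΓ0 : 0 ≤ Γ := zero_le_one.trans hΓ1
  have h := norm_iteratedDeriv_comp_le_pow (g := g) hOo (hgc.of_le (by exact_mod_cast le_top)) hv
    (hKO hvt') (fun i hi ↦ hC (v t) hvt' i hi) hvb hj
  refine h.trans ?_
  have h1 : (j ! : ℝ) ≤ k ! := by exact_mod_cast Nat.factorial_le hj
  gcongr

/-- **Degree law for the lab velocity** `v = ũ/u⁰` (both signs of `u⁰`). For every order `k`
and bound `γ ≥ 1` there is `C ≥ 0` such that for every `Cᵏ` path `u` with `|u⁰(t)| ≥ 1`,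
`‖u(t)‖ ≤ 2γ` and `‖u⁽ⁱ⁾(t)‖ ≤ Γⁱ` (`1 ≤ i ≤ k`, `Γ ≥ 1`): `‖v⁽ʲ⁾(t)‖ ≤ C Γʲ` for `j ≤ k`
(smoothness of `u ↦ ũ/u⁰` on `{u⁰ ≠ 0}`, `contDiffAt_labVelocityMap`; compactness of
`{1 ≤ |u⁰|, ‖u‖ ≤ 2γ}`; degree law for composites). [folklore] -/
theorem exists_norm_iteratedDeriv_labVelocity_le_pow (k : ℕ) (γ : ℝ) :
    ∃ C : ℝ, 0 ≤ C ∧ ∀ (u : ℝ → E4) (t : ℝ) (Γ : ℝ), 1 ≤ Γ → ContDiff ℝ k u →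
      1 ≤ |u t 0| → ‖u t‖ ≤ 2 * γ →
      (∀ i, 1 ≤ i → i ≤ k → ‖iteratedDeriv i u t‖ ≤ Γ ^ i) →
      ∀ j ≤ k, ‖iteratedDeriv j (fun s ↦ ((u s) 0)⁻¹ • E4.spatial (u s)) t‖ ≤ C * Γ ^ j := by
  set g : E4 → E3 := fun w ↦ (w 0)⁻¹ • E4.spatial w with hg
  set O : Set E4 := {w | w 0 ≠ 0} with hO
  have hOo : IsOpen O := isOpen_ne_fun (EuclideanSpace.proj (0 : Fin 4)).continuous continuous_const
  have hgc : ContDiffOn ℝ ∞ g O := fun w hw ↦ (contDiffAt_labVelocityMap hw).contDiffWithinAt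
  set K : Set E4 := {w | 1 ≤ |w 0|} ∩ closedBall 0 (2 * γ) with hK
  have hKc : IsCompact K :=
    (isCompact_closedBall _ _).inter_left
      (isClosed_le continuous_const (continuous_abs.comp (EuclideanSpace.proj (0 : Fin 4)).continuous))
  have hKO : K ⊆ O := fun w hw h0 ↦ by
    have h1 : 1 ≤ |w 0| := hw.1
    rw [show w 0 = 0 from h0, abs_zero] at h1
    exact absurd h1 (by norm_num)
  obtain ⟨C, hC0, hC⟩ := exists_forall_norm_iteratedFDeriv_le_of_isCompact hOo hgc hKc hKO k
  refine ⟨k ! * C, by positivity, fun u t Γ hΓ1 hu hu0 hub hub' j hj ↦ ?_⟩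
  have hut : u t ∈ K := ⟨hu0, by simpa using hub⟩
  have h := norm_iteratedDeriv_comp_le_pow (g := g) hOo (hgc.of_le (by exact_mod_cast le_top)) hu
    (hKO hut) (fun i hi ↦ hC (u t) hut i hi) hub' hj
  refine h.trans ?_
  have hΓ0 : 0 ≤ Γ := zero_le_one.trans hΓ1
  have h1 : (j ! : ℝ) ≤ k ! := by exact_mod_cast Nat.factorial_le hj
  gcongr

/-! ### The painted `4`-velocity: speed, size and Lorentz factor (sign-blind) -/

/-- For `u = Λ e₀`, `Λ ∈ O(1,3)`, with `|u⁰| ≤ γ`: the lab velocity `(u⁰)⁻¹ũ` lies in the closed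
ball of radius `√(1 − (γ²)⁻¹) < 1`, `‖u‖ ≤ 2γ`, and `γ(v) = |u⁰|` (`(u⁰)² = 1 + ‖ũ‖²`,
`lorentz_apply_zero_sq`). O'Neill 1983, Ch. 9, p. 233. [folklore] -/
theorem labVelocity_facts (Λ : lorentzGroup) {γ : ℝ}
    (hγ : |((Λ : E4 ≃L[ℝ] E4) (E4.basisVector 0)) 0| ≤ γ) :
    ((((Λ : E4 ≃L[ℝ] E4) (E4.basisVector 0)) 0)⁻¹ •
        E4.spatial ((Λ : E4 ≃L[ℝ] E4) (E4.basisVector 0))) ∈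
        closedBall (0 : E3) (Real.sqrt (1 - (γ ^ 2)⁻¹)) ∧
      ‖(Λ : E4 ≃L[ℝ] E4) (E4.basisVector 0)‖ ≤ 2 * γ ∧
      Lorentz.gamma ((((Λ : E4 ≃L[ℝ] E4) (E4.basisVector 0)) 0)⁻¹ •
        E4.spatial ((Λ : E4 ≃L[ℝ] E4) (E4.basisVector 0))) =
        |((Λ : E4 ≃L[ℝ] E4) (E4.basisVector 0)) 0| := by
  set u : E4 := (Λ : E4 ≃L[ℝ] E4) (E4.basisVector 0) with hu
  have hsq := lorentz_apply_zero_sq Λ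
  rw [← hu] at hsq
  have h1 : 1 ≤ |u 0| := by
    have := one_le_abs_lorentz_apply_zero Λ; rwa [← hu] at this
  have hu0 : u 0 ≠ 0 := fun h ↦ by rw [h, abs_zero] at h1; exact absurd h1 (by norm_num)
  have hu0sq : 0 < u 0 ^ 2 := by positivity
  have hγ1 : 1 ≤ γ := h1.trans hγ
  have hsn : E4.spatialNorm u = ‖E4.spatial u‖ := rfl
  -- speed
  have hv2 : ‖(u 0)⁻¹ • E4.spatial u‖ ^ 2 = 1 - (u 0 ^ 2)⁻¹ := by
    rw [norm_smul, mul_pow, norm_inv, Real.norm_eq_abs, inv_pow, sq_abs, ← hsn]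
    field_simp
    linarith
  have hv2' : ‖(u 0)⁻¹ • E4.spatial u‖ ^ 2 ≤ 1 - (γ ^ 2)⁻¹ := by
    rw [hv2]
    have : u 0 ^ 2 ≤ γ ^ 2 := by
      calc u 0 ^ 2 = |u 0| ^ 2 := (sq_abs _).symm
        _ ≤ γ ^ 2 := pow_le_pow_left₀ (abs_nonneg _) hγ 2
    have h3 : (γ ^ 2)⁻¹ ≤ (u 0 ^ 2)⁻¹ := inv_anti₀ hu0sq this
    linarith
  refine ⟨?_, ?_, ?_⟩
  · rw [mem_closedBall, dist_zero_right]
    exact Real.le_sqrt_of_sq_le hv2'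
  · have hn := norm_sq_eq_sq_add_spatialNorm_sq u
    have h2 : ‖u‖ ^ 2 ≤ (2 * γ) ^ 2 := by
      rw [hn]
      have : u 0 ^ 2 ≤ γ ^ 2 := by
        calc u 0 ^ 2 = |u 0| ^ 2 := (sq_abs _).symm
          _ ≤ γ ^ 2 := pow_le_pow_left₀ (abs_nonneg _) hγ 2
      nlinarith
    exact (pow_le_pow_iff_left₀ (norm_nonneg _) (by positivity) two_ne_zero).mp h2
  · unfold Lorentz.gamma
    rw [hv2, show (1 : ℝ) - (1 - (u 0 ^ 2)⁻¹) = (u 0 ^ 2)⁻¹ by ring, Real.sqrt_inv, Real.sqrt_sq_eq_abs,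
      inv_inv]

/-- **The boost of the lab velocity reproduces the painted `4`-velocity up to time orientation**:
with `u = Λ e₀`, `v = (u⁰)⁻¹ũ`: `boost(v) e₀ = u` if `u⁰ > 0` and `= −u` if `u⁰ < 0`
(`boost(v) e₀ = (γ(v), γ(v) v)`, `γ(v) = |u⁰|`). [folklore] -/
theorem boost_labVelocity_apply_basisVector_zero (Λ : lorentzGroup)
    (hv : ‖((((Λ : E4 ≃L[ℝ] E4) (E4.basisVector 0)) 0)⁻¹ •
        E4.spatial ((Λ : E4 ≃L[ℝ] E4) (E4.basisVector 0)))‖ < 1) :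
    (Lorentz.boost _ hv : E4 ≃L[ℝ] E4) (E4.basisVector 0) =
      (|((Λ : E4 ≃L[ℝ] E4) (E4.basisVector 0)) 0| * (((Λ : E4 ≃L[ℝ] E4) (E4.basisVector 0)) 0)⁻¹) •
        (Λ : E4 ≃L[ℝ] E4) (E4.basisVector 0) := by
  have hγ := (labVelocity_facts Λ le_rfl).2.2
  have h1 : 1 ≤ |((Λ : E4 ≃L[ℝ] E4) (E4.basisVector 0)) 0| := one_le_abs_lorentz_apply_zero Λ
  have hu0 : ((Λ : E4 ≃L[ℝ] E4) (E4.basisVector 0)) 0 ≠ 0 := fun h ↦ by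
    rw [h, abs_zero] at h1; exact absurd h1 (by norm_num)
  rw [Lorentz.boost_apply_basisVector_zero, hγ, smul_smul]
  ext μ
  refine Fin.cases ?_ (fun i ↦ ?_) μ
  · rw [E4.ofTimeSpace_apply_zero, PiLp.smul_apply, smul_eq_mul, inv_mul_cancel_right₀ hu0]
  · rw [E4.ofTimeSpace_apply_succ, PiLp.smul_apply, PiLp.smul_apply, E4.spatial_apply, smul_eq_mul]

/-! ### Representatives modulo the isotropy of the Schwarzschild field -/

/-- **Representative, orthochronous case.** If the pure boost of `v` has the same `4`-velocity as
`Λ`, `boost(v) e₀ = Λ e₀`, then the Schwarzschild summand painted with `Λ` is the one painted with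
the boost: `boostedKerrBilin Λ c M 0 x V W = g_{M,0}(boostCLM(−v)(x − c))(boostCLM(−v)V, boostCLM(−v)W)`
— `Λ⁻¹ = R ∘ boost(v)⁻¹` with `R = Λ⁻¹ ∘ boost(v)` an `η`-isometry fixing `e₀`, invisible to
`g_{M,0}` (`schwarzschild_isotropy`). Kerr–Schild 1965, §2. [folklore] -/
theorem boostedKerrBilin_zero_spin_eq_boost_repr (Λ : lorentzGroup) {v : E3} (hv : ‖v‖ < 1)
    (hΛv : (Lorentz.boost v hv : E4 ≃L[ℝ] E4) (E4.basisVector 0) = (Λ : E4 ≃L[ℝ] E4) (E4.basisVector 0))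
    (M : ℝ) (c x V W : E4) :
    boostedKerrBilin Λ c M 0 x V W = Kerr.bilin M 0 (Lorentz.boostCLM (-v) (x - c))
      (Lorentz.boostCLM (-v) V) (Lorentz.boostCLM (-v) W) := by
  set R : E4 → E4 := fun w ↦ (Λ : E4 ≃L[ℝ] E4).symm (Lorentz.boostCLM v w) with hR
  have hsymm : ∀ a b : E4, Minkowski.bilin ((Λ : E4 ≃L[ℝ] E4).symm a) ((Λ : E4 ≃L[ℝ] E4).symm b) =
      Minkowski.bilin a b := by
    intro a b
    have h := Λ.2 ((Λ : E4 ≃L[ℝ] E4).symm a) ((Λ : E4 ≃L[ℝ] E4).symm b)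
    rw [ContinuousLinearEquiv.apply_symm_apply, ContinuousLinearEquiv.apply_symm_apply] at h
    exact h.symm
  have hRiso : ∀ a b : E4, Minkowski.bilin (R a) (R b) = Minkowski.bilin a b := fun a b ↦ by
    rw [hR, hsymm, Lorentz.minkowski_boostCLM hv]
  have hR0 : R (E4.basisVector 0) = E4.basisVector 0 := by
    show (Λ : E4 ≃L[ℝ] E4).symm (Lorentz.boostCLM v (E4.basisVector 0)) = E4.basisVector 0
    rw [← Lorentz.coe_boost_apply hv, hΛv, ContinuousLinearEquiv.symm_apply_apply]
  have hvv : ‖-v‖ < 1 := by rwa [norm_neg]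
  have hback : ∀ z : E4, Lorentz.boostCLM v (Lorentz.boostCLM (-v) z) = z := fun z ↦ by
    have := boostCLM_neg_apply_boostCLM hvv z
    rwa [neg_neg] at this
  have key := QuasiStationarity.schwarzschild_isotropy hRiso hR0 M (Lorentz.boostCLM (-v) (x - c))
    (Lorentz.boostCLM (-v) V) (Lorentz.boostCLM (-v) W)
  simp only [hR, hback] at key
  rw [← key, boostedKerrBilin_apply]
  rfl

/-- **Representative, time-reversing case.** If `boost(v) e₀ = −Λ e₀`, then
`boostedKerrBilin Λ c M 0 x V W = g_{M,0}(T boostCLM(−v)(x − c))(T boostCLM(−v)V, T boostCLM(−v)W)`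
with the time reflection `T w = w − 2w⁰e₀` (`R = Λ⁻¹ ∘ boost(v) ∘ T` fixes `e₀`). [folklore] -/
theorem boostedKerrBilin_zero_spin_eq_reflect_boost_repr (Λ : lorentzGroup) {v : E3} (hv : ‖v‖ < 1)
    (hΛv : (Lorentz.boost v hv : E4 ≃L[ℝ] E4) (E4.basisVector 0) = -(Λ : E4 ≃L[ℝ] E4) (E4.basisVector 0))
    (M : ℝ) (c x V W : E4) :
    boostedKerrBilin Λ c M 0 x V W =
      Kerr.bilin M 0 (Lorentz.boostCLM (-v) (x - c) - (2 * Lorentz.boostCLM (-v) (x - c) 0) • E4.basisVector 0)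
        (Lorentz.boostCLM (-v) V - (2 * Lorentz.boostCLM (-v) V 0) • E4.basisVector 0)
        (Lorentz.boostCLM (-v) W - (2 * Lorentz.boostCLM (-v) W 0) • E4.basisVector 0) := by
  set T : E4 → E4 := fun w ↦ w - (2 * w 0) • E4.basisVector 0 with hT
  set R : E4 → E4 := fun w ↦ (Λ : E4 ≃L[ℝ] E4).symm (Lorentz.boostCLM v (T w)) with hR
  have hsymm : ∀ a b : E4, Minkowski.bilin ((Λ : E4 ≃L[ℝ] E4).symm a) ((Λ : E4 ≃L[ℝ] E4).symm b) =
      Minkowski.bilin a b := by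
    intro a b
    have h := Λ.2 ((Λ : E4 ≃L[ℝ] E4).symm a) ((Λ : E4 ≃L[ℝ] E4).symm b)
    rw [ContinuousLinearEquiv.apply_symm_apply, ContinuousLinearEquiv.apply_symm_apply] at h
    exact h.symm
  -- the time reflection is an `η`-isometry and an involution
  have hTiso : ∀ a b : E4, Minkowski.bilin (T a) (T b) = Minkowski.bilin a b := fun a b ↦ by
    simp only [hT, Minkowski.bilin_apply, PseudotensorBound.reflect_apply, Fin.succ_ne_zero]
    simp
  have hTT : ∀ w : E4, T (T w) = w := fun w ↦ by
    have h0 : (w - (2 * w 0) • E4.basisVector 0) 0 = -w 0 := by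
      rw [PseudotensorBound.reflect_apply]; simp
    show (w - (2 * w 0) • E4.basisVector 0) -
      (2 * (w - (2 * w 0) • E4.basisVector 0) 0) • E4.basisVector 0 = w
    rw [h0]
    ext μ
    simp only [PiLp.sub_apply, PiLp.smul_apply, smul_eq_mul]
    ring
  have hRiso : ∀ a b : E4, Minkowski.bilin (R a) (R b) = Minkowski.bilin a b := fun a b ↦ by
    rw [hR, hsymm, Lorentz.minkowski_boostCLM hv]
    exact hTiso a b
  have hT0 : T (E4.basisVector 0) = -E4.basisVector 0 := by
    show E4.basisVector 0 - (2 * (E4.basisVector 0 : E4) 0) • E4.basisVector 0 = -E4.basisVector 0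
    have : (E4.basisVector 0 : E4) 0 = 1 := by simp [E4.basisVector]
    rw [this, mul_one, two_smul]
    abel
  have hR0 : R (E4.basisVector 0) = E4.basisVector 0 := by
    show (Λ : E4 ≃L[ℝ] E4).symm (Lorentz.boostCLM v (T (E4.basisVector 0))) = E4.basisVector 0
    rw [hT0, map_neg, ← Lorentz.coe_boost_apply hv, hΛv, neg_neg, ContinuousLinearEquiv.symm_apply_apply]
  have hvv : ‖-v‖ < 1 := by rwa [norm_neg]
  have hback : ∀ z : E4, Lorentz.boostCLM v (T (T (Lorentz.boostCLM (-v) z))) = z := fun z ↦ by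
    have := boostCLM_neg_apply_boostCLM hvv z
    rw [neg_neg] at this
    rw [hTT, this]
  have key := QuasiStationarity.schwarzschild_isotropy hRiso hR0 M (T (Lorentz.boostCLM (-v) (x - c)))
    (T (Lorentz.boostCLM (-v) V)) (T (Lorentz.boostCLM (-v) W))
  simp only [hR, hback] at key
  rw [← key, boostedKerrBilin_apply]
  rfl

/-- **Registered sub-goal form** (worker carrier `slaving_boost_repr_degree_law` of the crux item)
of `exists_norm_iteratedDeriv_boostCLM_neg_le_pow`: degree law for the rest-frame boost in the jets
of the lab velocity. [folklore] -/
theorem slaving_boost_repr_degree_law : open Literature.Geometry.Lorentzian in ∀ (k : ℕ) {κ₀ : ℝ}, κ₀ < 1 → ∃ C : ℝ, 0 ≤ C ∧ ∀ (v : ℝ → E3) (t : ℝ) (Γ : ℝ), 1 ≤ Γ → ContDiff ℝ k v → ‖v t‖ ≤ κ₀ → (∀ i, 1 ≤ i → i ≤ k → ‖iteratedDeriv i v t‖ ≤ Γ ^ i) → ∀ j ≤ k, ‖iteratedDeriv j (fun s ↦ Lorentz.boostCLM (-v s)) t‖ ≤ C * Γ ^ j :=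
  fun k _ hκ₀ ↦ exists_norm_iteratedDeriv_boostCLM_neg_le_pow k hκ₀

end Summit.FinalStateConjecture.FinalStateConjecture.Theorems.SublinearIsFree.Slaving

end
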